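import Summits.QuantumFields.QCD.Theorems.NestedDissectionSeaRobustYangMillsRGStubFormatBallClusteringFalseAux
import Literature.Barriers.QuantumFields.ElitzurTheorem
import Literature.MathematicalPhysics.QuantumFieldTheory.StrongCouplingActivities
import HarnessLib

/-!
# Toolkit for `stub_formatBallClustering_false` (line `birth`, crux `RobustYangMillsRG`,
# item stmt-QuantumFields-17812), part II: tail-site gauge averaging and the finite-energy bound

The two volume-uniform analytic lemmas of the negative certificate, on the torus `(ZMod M)^4` with
a compact second-countable gauge group `G`, for an arbitrary set of sites `T`, region functional
`LF` and weight `Ψ` subject to explicit hypotheses (instantiated downstream with the sign sites,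
the format's rough region at `ε = 1` and the Gibbs factor `e^{-β S_W}`):

* **tail-site gauge averaging** (`integral_weight_mul_prod_apply_eq`, registered in its `SU(3)`
  form as `stub_formatBallClustering_signAveraging`): if `T` is shift-free in direction `1`, `LF`
  and `Ψ` are gauge invariant and measurable, `|Ψ| ≤ 1`, then for every measurable `f : G → [-1,1]`
  `∫ Ψ ∏_{y ∈ T ∩ LF V} f(V(y,1)) = ∫ Ψ (∫ f)^{#(T ∩ LF V)}` — average one site at a time over the
  gauge transformation at `y` (preserves `μ`, `Ψ`, `LF`; multiplies `V(y,1)` on the left and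
  touches no other `V(y',1)`, `y' ∈ T`);
* **finite-energy lower bound** (`integral_weight_mul_prod_indicator_ge`): if right-multiplying
  the link `(y,2)` costs at most a factor `κ₀` in `Ψ`, leaves the other sites' membership in `LF`
  unchanged and puts `y` into `LF` whenever `V(y,2) a R(V) ∈ S₁`, then for `y ∈ T`
  `κ₀ m Haar(S₁) ∫ Ψ m^X ≤ ∫ Ψ m^X 1[y ∈ LF V]`; whence the **growth bound**
  `(1 + (ratio - 1) κ₀ m Haar(S₁) #T) I(m) ≤ I(m · ratio)` (`growth_integral_weight_mul_prod`).
-/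

noncomputable section

namespace Summit.QuantumFields.QCD.Cruxes.RobustYangMillsRG.Birth

open scoped BigOperators Topology Manifold Classical MeasureTheory ProbabilityTheory Matrix InnerProductSpace ComplexConjugate ContinuousMap
open Filter Set Function TopologicalSpace MeasureTheory
open Literature.MathematicalPhysics.QuantumLattice Literature.MathematicalPhysics.AQFT
  Literature.MathematicalPhysics.QuantumFieldTheory

namespace SignedFormat

/-! ### Tail-site gauge averaging: `∫ Ψ · ∏ f(V(y,1)) = ∫ Ψ · (∫ f)^X` -/

section SignAveraging

variable {M : ℕ} {G : Type*} {T : Finset (Site 4 M)} {LF : GaugeConfig 4 M G → Finset (Site 4 M)}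

/-- The MIXED products of the induction (sites in `R` already averaged) are measurable. [folklore] -/
theorem measurable_mixedProd [MeasurableSpace G] (hLFm : ∀ y, MeasurableSet {V | y ∈ LF V}) {f : G → ℝ} (hf : Measurable f)
    (mf : ℝ) (R : Finset (Site 4 M)) :
    Measurable fun V => ∏ y ∈ T, (if y ∈ LF V then (if y ∈ R then mf else f (V (y, 1))) else 1) := by
  refine Finset.measurable_prod _ fun y _ => Measurable.ite (hLFm y) ?_ measurable_const
  by_cases hyR : y ∈ R
  · simp only [hyR, if_true]; exact measurable_const
  · simp only [hyR, if_false]; exact hf.comp (measurable_pi_apply _)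

/-- The mixed products are bounded by one (`|f|, |mf| ≤ 1`). [folklore] -/
theorem abs_mixedProd_le_one {f : G → ℝ} (hf1 : ∀ u, |f u| ≤ 1) {mf : ℝ} (hmf1 : |mf| ≤ 1)
    (R : Finset (Site 4 M)) (V : GaugeConfig 4 M G) :
    |∏ y ∈ T, (if y ∈ LF V then (if y ∈ R then mf else f (V (y, 1))) else 1)| ≤ 1 := by
  rw [Finset.abs_prod]
  refine Finset.prod_le_one (fun y _ => abs_nonneg _) fun y _ => ?_
  split_ifs
  · exact hmf1
  · exact hf1 _
  · simp

/-- **The one-site computation.** Under the gauge transformation `a` at the site `y ∈ T \\ R` the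
mixed product changes only through the factor at `y`, which becomes `f(a · V(y,1))`: the rough region
is gauge invariant, the links `(y', 1)`, `y' ∈ T \\ {y}`, neither start nor end at `y`
(shift-freeness of `T` in direction `1`), and `(y, 1)` starts but does not end at `y`. [folklore] -/
theorem mixedProd_gaugeTransform_update [Group G] (hT : ∀ y ∈ T, ∀ y' ∈ T, y'.shift 1 ≠ y)
    (hLFg : ∀ (g : Site 4 M → G) V, LF (gaugeTransform g V) = LF V) {f : G → ℝ} {mf : ℝ}
    {R : Finset (Site 4 M)} {y : Site 4 M} (hy : y ∈ T) (hyR : y ∉ R) (a : G) (V : GaugeConfig 4 M G) :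
    ∏ y' ∈ T, (if y' ∈ LF (gaugeTransform (Function.update 1 y a) V) then
        (if y' ∈ R then mf else f (gaugeTransform (Function.update 1 y a) V (y', 1))) else 1) =
      (if y ∈ LF V then f (a * V (y, 1)) else 1) *
        ∏ y' ∈ T.erase y, (if y' ∈ LF V then (if y' ∈ R then mf else f (V (y', 1))) else 1) := by
  rw [hLFg, ← Finset.mul_prod_erase _ _ hy]
  congr 1
  · simp only [hyR, if_false, gaugeTransform_update_apply_base (hT y hy y hy)]
  · refine Finset.prod_congr rfl fun y' hy' => ?_
    obtain ⟨hne, hy'T⟩ := Finset.mem_erase.1 hy'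
    rw [gaugeTransform_update_apply_of_ne hne (hT y hy y' hy'T)]

/-- Splitting the factor at `y` off the mixed product of `insert y R`. [folklore] -/
theorem mixedProd_insert {f : G → ℝ} {mf : ℝ} {R : Finset (Site 4 M)} {y : Site 4 M} (hy : y ∈ T)
    (V : GaugeConfig 4 M G) :
    ∏ y' ∈ T, (if y' ∈ LF V then (if y' ∈ insert y R then mf else f (V (y', 1))) else 1) =
      (if y ∈ LF V then mf else 1) *
        ∏ y' ∈ T.erase y, (if y' ∈ LF V then (if y' ∈ R then mf else f (V (y', 1))) else 1) := by
  rw [← Finset.mul_prod_erase _ _ hy]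
  congr 1
  · simp
  · refine Finset.prod_congr rfl fun y' hy' => ?_
    obtain ⟨hne, -⟩ := Finset.mem_erase.1 hy'
    simp only [Finset.mem_insert, hne, false_or]

variable [NeZero M] [Group G] [MeasurableSpace G] [TopologicalSpace G] [IsTopologicalGroup G]
  [CompactSpace G] [SecondCountableTopology G] [BorelSpace G]

/-- **Tail-site gauge averaging.** On the torus `(ZMod M)^4` with a compact gauge group `G`, let `T`
be a set of sites that is shift-free in direction `1`, `LF(V)` a gauge-invariant region with
measurable membership events, `Ψ` a gauge-invariant measurable weight with `|Ψ| ≤ 1`, and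
`f : G → [-1, 1]` measurable. Then
`∫ Ψ(V) ∏_{y ∈ T ∩ LF(V)} f(V(y,1)) dV = ∫ Ψ(V) (∫ f dHaar)^{#(T ∩ LF(V))} dV`: under the invariant
weight the links `V(y,1)`, `y ∈ T`, are i.i.d. Haar given the roughness pattern. Proof: average one
site at a time over the gauge transformation `a ↦ γ_a` at `y` (`∫ H dμ = ∫∫ H(γ_a • V) da dμ` by
invariance of product Haar + Fubini), which replaces `f(V(y,1))` by `∫ f(a V(y,1)) da = ∫ f` (left
invariance of Haar) and touches nothing else. [folklore] -/
theorem integral_weight_mul_prod_apply_eq (hT : ∀ y ∈ T, ∀ y' ∈ T, y'.shift 1 ≠ y)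
    (hLFg : ∀ (g : Site 4 M → G) V, LF (gaugeTransform g V) = LF V)
    (hLFm : ∀ y, MeasurableSet {V | y ∈ LF V}) {Ψ : GaugeConfig 4 M G → ℝ} (hΨm : Measurable Ψ)
    (hΨ1 : ∀ V, |Ψ V| ≤ 1) (hΨg : ∀ (g : Site 4 M → G) V, Ψ (gaugeTransform g V) = Ψ V) {f : G → ℝ}
    (hf : Measurable f) (hf1 : ∀ u, |f u| ≤ 1) :
    ∫ V, Ψ V * ∏ y ∈ T, (if y ∈ LF V then f (V (y, 1)) else 1) ∂(Measure.pi fun _ : Edge 4 M => haarProbability G) =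
      ∫ V, Ψ V * ∏ y ∈ T, (if y ∈ LF V then ∫ u, f u ∂haarProbability G else 1)
        ∂Measure.pi fun _ : Edge 4 M => haarProbability G := by
  set μ : Measure (GaugeConfig 4 M G) := Measure.pi fun _ => haarProbability G with hμ
  set mf : ℝ := ∫ u, f u ∂haarProbability G with hmf
  have hmf1 : |mf| ≤ 1 := abs_integral_haar_le_one hf1
  -- the mixed products `P R`
  set P : Finset (Site 4 M) → GaugeConfig 4 M G → ℝ := fun R V =>
    ∏ y ∈ T, (if y ∈ LF V then (if y ∈ R then mf else f (V (y, 1))) else 1) with hP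
  have hHm : ∀ R : Finset (Site 4 M), Measurable fun V : GaugeConfig 4 M G => Ψ V * P R V := fun R =>
    hΨm.mul (measurable_mixedProd hLFm hf mf R)
  have hHb : ∀ R (V : GaugeConfig 4 M G), |Ψ V * P R V| ≤ 1 := fun R V => by
    rw [abs_mul]
    exact mul_le_one₀ (hΨ1 V) (abs_nonneg _) (abs_mixedProd_le_one hf1 hmf1 R V)
  -- induction over the set `R ⊆ T` of already-averaged sites
  have key : ∫ V, Ψ V * P T V ∂μ = ∫ V, Ψ V * P ∅ V ∂μ := by
    refine Finset.induction_on' (motive := fun R => ∫ V, Ψ V * P R V ∂μ = ∫ V, Ψ V * P ∅ V ∂μ) T rfl ?_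
    intro y R hyT _ hyR ih
    rw [← ih, integral_eq_integral_average (μ := μ) (ν := haarProbability G)
      (Φ := fun a V => gaugeTransform (Function.update 1 y a) V) (measurable_gaugeTransform_update₂ y)
      (fun a => Literature.Barriers.QuantumFields.Elitzur.measurePreserving_gaugeTransform _)
      (hHm R) (hHb R)]
    refine integral_congr_ae (ae_of_all _ fun V => ?_)
    have hI : ∫ a, (if y ∈ LF V then f (a * V (y, 1)) else (1 : ℝ)) ∂haarProbability G =
        if y ∈ LF V then mf else 1 := by
      by_cases hr : y ∈ LF V
      · simp only [hr, if_true, hmf]; exact integral_mul_right_eq_self f (V (y, 1))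
      · simp only [hr, if_false, integral_const, probReal_univ, one_smul]
    simp only [hP, hΨg, mixedProd_gaugeTransform_update hT hLFg hyT hyR, mixedProd_insert hyT]
    rw [integral_const_mul, integral_mul_const, hI]
  have hP0 : ∀ V, P ∅ V = ∏ y ∈ T, (if y ∈ LF V then f (V (y, 1)) else 1) := fun V => by
    simp [hP]
  have hPT : ∀ V, P T V = ∏ y ∈ T, (if y ∈ LF V then mf else 1) := fun V =>
    Finset.prod_congr rfl fun y hy => by simp [hy]
  simp only [hP0, hPT] at key
  exact key.symm

end SignAveraging

/-! ### Finite-energy lower bound: rough sites have density `≥ δ > 0`, uniformly in the volume -/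

section Growth

variable {M : ℕ} {G : Type*} {T : Finset (Site 4 M)} {LF : GaugeConfig 4 M G → Finset (Site 4 M)}

/-- Modifying one link at a site `y ∈ T` that leaves the roughness of the other sites of `T`
unchanged lowers the rough-count product by at most a factor `m` (`0 ≤ m ≤ 1`). [folklore] -/
theorem mul_prod_le_prod_of_off_site {m : ℝ} (hm0 : 0 ≤ m) (hm1 : m ≤ 1) {y : Site 4 M} (hy : y ∈ T)
    {V V' : GaugeConfig 4 M G} (hVV' : ∀ y' ∈ T, y' ≠ y → (y' ∈ LF V' ↔ y' ∈ LF V)) :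
    m * ∏ y' ∈ T, (if y' ∈ LF V then m else 1) ≤ ∏ y' ∈ T, (if y' ∈ LF V' then m else 1) := by
  rw [← Finset.mul_prod_erase _ _ hy, ← Finset.mul_prod_erase T _ hy]
  have hK : ∏ y' ∈ T.erase y, (if y' ∈ LF V' then m else 1) = ∏ y' ∈ T.erase y, (if y' ∈ LF V then m else 1) := by
    refine Finset.prod_congr rfl fun y' hy' => ?_
    obtain ⟨hne, hy'T⟩ := Finset.mem_erase.1 hy'
    simp only [hVV' y' hy'T hne]
  rw [hK]
  have hK0 : 0 ≤ ∏ y' ∈ T.erase y, (if y' ∈ LF V then m else 1) :=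
    Finset.prod_nonneg fun _ _ => by split_ifs <;> positivity
  have hc' : m ≤ (if y ∈ LF V' then m else 1) := by
    split_ifs
    · exact le_rfl
    · exact hm1
  have hc : (if y ∈ LF V then m else 1) ≤ 1 := by
    split_ifs
    · exact hm1
    · exact le_rfl
  calc m * ((if y ∈ LF V then m else 1) * _) ≤ m * (1 * _) :=
        mul_le_mul_of_nonneg_left (mul_le_mul_of_nonneg_right hc hK0) hm0
    _ = m * _ := by rw [one_mul]
    _ ≤ _ := mul_le_mul_of_nonneg_right hc' hK0

variable [Group G] {Ψ : GaugeConfig 4 M G → ℝ} {κ₀ m : ℝ} {S₁ : Set G}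

/-- **Pointwise finite-energy bound.** After right-multiplying the link `(y, 2)` by `a`, the
integrand `Ψ m^X 1[y rough]` dominates `κ₀ Ψ(V) · m · m^{X(V)} · 1[V(y,2) a R(V) ∈ S₁]`, where
`R(V) = V(y+e₂,3) V(y+e₃,2)⁻¹ V(y,3)⁻¹`: the weight drops by at most `κ₀` (finite energy), the
roughness of the other sites is unchanged and the factor at `y` is `≥ m`, and `y` becomes rough
whenever `V(y,2) a R(V) ∈ S₁` (the rough-plaquette criterion). [folklore] -/
theorem indicator_le_integrand_update (hΨ0 : ∀ V, 0 < Ψ V)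
    (hΨu : ∀ y ∈ T, ∀ (V : GaugeConfig 4 M G) (a : G), κ₀ * Ψ V ≤ Ψ (Function.update V (y, 2) (V (y, 2) * a)))
    (hm0 : 0 < m) (hm1 : m ≤ 1)
    (hLFu : ∀ y ∈ T, ∀ y' ∈ T, y' ≠ y → ∀ (V : GaugeConfig 4 M G) (a : G),
      (y' ∈ LF (Function.update V (y, 2) (V (y, 2) * a)) ↔ y' ∈ LF V))
    (hcrit : ∀ y ∈ T, ∀ (V : GaugeConfig 4 M G) (a : G),
      V (y, 2) * a * (V (y.shift 2, 3) * (V (y.shift 3, 2))⁻¹ * (V (y, 3))⁻¹) ∈ S₁ →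
        y ∈ LF (Function.update V (y, 2) (V (y, 2) * a)))
    {y : Site 4 M} (hy : y ∈ T) (V : GaugeConfig 4 M G) (a : G) :
    κ₀ * Ψ V * (m * ∏ y' ∈ T, (if y' ∈ LF V then m else 1)) *
        S₁.indicator 1 (V (y, 2) * a * (V (y.shift 2, 3) * (V (y.shift 3, 2))⁻¹ * (V (y, 3))⁻¹)) ≤
      Ψ (Function.update V (y, 2) (V (y, 2) * a)) *
        (∏ y' ∈ T, (if y' ∈ LF (Function.update V (y, 2) (V (y, 2) * a)) then m else 1)) *
          (if y ∈ LF (Function.update V (y, 2) (V (y, 2) * a)) then 1 else 0) := by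
  set R : G := V (y.shift 2, 3) * (V (y.shift 3, 2))⁻¹ * (V (y, 3))⁻¹ with hR
  set V' : GaugeConfig 4 M G := Function.update V (y, 2) (V (y, 2) * a) with hV'
  have h1 : κ₀ * Ψ V ≤ Ψ V' := hΨu y hy V a
  have h2 : m * ∏ y' ∈ T, (if y' ∈ LF V then m else 1) ≤ ∏ y' ∈ T, (if y' ∈ LF V' then m else 1) :=
    mul_prod_le_prod_of_off_site hm0.le hm1 hy fun y' hy' hne => hLFu y hy y' hy' hne V a
  have h3 : S₁.indicator 1 (V (y, 2) * a * R) ≤ (if y ∈ LF V' then (1 : ℝ) else 0) := by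
    by_cases hmem : V (y, 2) * a * R ∈ S₁
    · rw [Set.indicator_of_mem hmem, if_pos (hcrit y hy V a hmem), Pi.one_apply]
    · rw [Set.indicator_of_notMem hmem]; split_ifs <;> norm_num
  have h3' : 0 ≤ S₁.indicator (1 : G → ℝ) (V (y, 2) * a * R) :=
    Set.indicator_nonneg (fun _ _ => zero_le_one) _
  calc _ ≤ Ψ V' * (∏ y' ∈ T, (if y' ∈ LF V' then m else 1)) * S₁.indicator 1 (V (y, 2) * a * R) :=
        mul_le_mul_of_nonneg_right
          (mul_le_mul h1 h2 (mul_nonneg hm0.le (prod_ite_mem_nonneg T LF hm0.le V)) (hΨ0 _).le) h3'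
    _ ≤ _ := mul_le_mul_of_nonneg_left h3 (mul_nonneg (hΨ0 _).le (prod_ite_mem_nonneg T LF hm0.le _))

variable [MeasurableSpace G] [TopologicalSpace G] [IsTopologicalGroup G] [CompactSpace G]
  [SecondCountableTopology G] [BorelSpace G]

/-- **The one-link average.** For fixed `V`, averaging the pointwise bound over `a` (two-sided
invariance of Haar: `∫ 1[V(y,2) a R(V) ∈ S₁] da = Haar(S₁)`) gives
`κ₀ m Haar(S₁) · Ψ(V) m^{X(V)} ≤ ∫ (Ψ m^X 1[y rough])(V with link (y,2) multiplied by a) da`. [folklore] -/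
theorem le_integral_integrand_update (hΨm : Measurable Ψ) (hΨ0 : ∀ V, 0 < Ψ V) (hΨ1 : ∀ V, Ψ V ≤ 1)
    (hκ₀ : 0 ≤ κ₀)
    (hΨu : ∀ y ∈ T, ∀ (V : GaugeConfig 4 M G) (a : G), κ₀ * Ψ V ≤ Ψ (Function.update V (y, 2) (V (y, 2) * a)))
    (hLFm : ∀ y, MeasurableSet {V | y ∈ LF V}) (hm0 : 0 < m) (hm1 : m ≤ 1)
    (hLFu : ∀ y ∈ T, ∀ y' ∈ T, y' ≠ y → ∀ (V : GaugeConfig 4 M G) (a : G),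
      (y' ∈ LF (Function.update V (y, 2) (V (y, 2) * a)) ↔ y' ∈ LF V))
    (hS₁ : MeasurableSet S₁)
    (hcrit : ∀ y ∈ T, ∀ (V : GaugeConfig 4 M G) (a : G),
      V (y, 2) * a * (V (y.shift 2, 3) * (V (y.shift 3, 2))⁻¹ * (V (y, 3))⁻¹) ∈ S₁ →
        y ∈ LF (Function.update V (y, 2) (V (y, 2) * a)))
    {y : Site 4 M} (hy : y ∈ T) (V : GaugeConfig 4 M G) :
    κ₀ * m * (haarProbability G).real S₁ * (Ψ V * ∏ y' ∈ T, (if y' ∈ LF V then m else 1)) ≤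
      ∫ a, Ψ (Function.update V (y, 2) (V (y, 2) * a)) *
        (∏ y' ∈ T, (if y' ∈ LF (Function.update V (y, 2) (V (y, 2) * a)) then m else 1)) *
          (if y ∈ LF (Function.update V (y, 2) (V (y, 2) * a)) then 1 else 0) ∂haarProbability G := by
  set R : G := V (y.shift 2, 3) * (V (y.shift 3, 2))⁻¹ * (V (y, 3))⁻¹ with hR
  set c : ℝ := κ₀ * Ψ V * (m * ∏ y' ∈ T, (if y' ∈ LF V then m else 1)) with hc
  have hc0 : 0 ≤ c :=
    mul_nonneg (mul_nonneg hκ₀ (hΨ0 V).le) (mul_nonneg hm0.le (prod_ite_mem_nonneg T LF hm0.le V))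
  -- the lower integrand `a ↦ c · 1[V(y,2) a R ∈ S₁]`
  have hlm : Measurable fun a : G => c * S₁.indicator 1 (V (y, 2) * a * R) :=
    measurable_const.mul ((measurable_one.indicator hS₁).comp ((measurable_const_mul (V (y, 2))).mul_const R))
  have hind : ∀ a : G, 0 ≤ S₁.indicator (1 : G → ℝ) (V (y, 2) * a * R) ∧
      S₁.indicator (1 : G → ℝ) (V (y, 2) * a * R) ≤ 1 := fun a => by
    by_cases hmem : V (y, 2) * a * R ∈ S₁
    · rw [Set.indicator_of_mem hmem, Pi.one_apply]; exact ⟨zero_le_one, le_rfl⟩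
    · rw [Set.indicator_of_notMem hmem]; exact ⟨le_rfl, zero_le_one⟩
  have hlb : ∀ a : G, |c * S₁.indicator 1 (V (y, 2) * a * R)| ≤ c := fun a => by
    rw [abs_mul, abs_of_nonneg hc0, abs_of_nonneg (hind a).1]
    exact mul_le_of_le_one_right hc0 (hind a).2
  -- the upper integrand is bounded measurable
  have hlink : Measurable fun a : G => Function.update V (y, 2) (V (y, 2) * a) :=
    (measurable_linkUpdate₂ (y, 2)).comp (measurable_const.prodMk measurable_id)
  have hum : Measurable fun a : G => Ψ (Function.update V (y, 2) (V (y, 2) * a)) *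
      (∏ y' ∈ T, (if y' ∈ LF (Function.update V (y, 2) (V (y, 2) * a)) then m else 1)) *
        (if y ∈ LF (Function.update V (y, 2) (V (y, 2) * a)) then (1 : ℝ) else 0) :=
    ((hΨm.comp hlink).mul ((measurable_prod_ite_mem hLFm m).comp hlink)).mul
      (Measurable.ite ((hLFm y).preimage hlink) measurable_const measurable_const)
  have hub : ∀ a : G, |Ψ (Function.update V (y, 2) (V (y, 2) * a)) *
      (∏ y' ∈ T, (if y' ∈ LF (Function.update V (y, 2) (V (y, 2) * a)) then m else 1)) *
        (if y ∈ LF (Function.update V (y, 2) (V (y, 2) * a)) then (1 : ℝ) else 0)| ≤ 1 := fun a => by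
    rw [abs_mul, abs_mul, abs_of_pos (hΨ0 _), abs_of_nonneg (prod_ite_mem_nonneg T LF hm0.le _)]
    refine mul_le_one₀ (mul_le_one₀ (hΨ1 _) (prod_ite_mem_nonneg T LF hm0.le _)
      (prod_ite_mem_le_one T LF hm0.le hm1 _)) (abs_nonneg _) ?_
    split_ifs <;> norm_num
  calc κ₀ * m * (haarProbability G).real S₁ * (Ψ V * ∏ y' ∈ T, (if y' ∈ LF V then m else 1))
      = c * (haarProbability G).real S₁ := by rw [hc]; ring
    _ = ∫ a, c * S₁.indicator 1 (V (y, 2) * a * R) ∂haarProbability G := by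
        rw [integral_const_mul, integral_indicator_mul_mul hS₁]
    _ ≤ _ := integral_mono (integrable_of_abs_le hlm.aestronglyMeasurable hlb)
        (integrable_of_abs_le hum.aestronglyMeasurable hub)
        fun a => indicator_le_integrand_update hΨ0 hΨu hm0 hm1 hLFu hcrit hy V a

variable [NeZero M]

/-- **Rough sites have uniformly positive density** under `Ψ m^X dμ`: for every `y ∈ T`,
`δ ∫ Ψ m^X ≤ ∫ Ψ m^X 1[y ∈ LF]` with `δ = κ₀ · m · Haar(S₁)` — the averaging identity for right
multiplication of the link `(y, 2)` (which preserves `μ`), then `le_integral_integrand_update`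
pointwise in `V`. [folklore] -/
theorem integral_weight_mul_prod_indicator_ge (hΨm : Measurable Ψ) (hΨ0 : ∀ V, 0 < Ψ V)
    (hΨ1 : ∀ V, Ψ V ≤ 1) (hκ₀ : 0 ≤ κ₀)
    (hΨu : ∀ y ∈ T, ∀ (V : GaugeConfig 4 M G) (a : G), κ₀ * Ψ V ≤ Ψ (Function.update V (y, 2) (V (y, 2) * a)))
    (hLFm : ∀ y, MeasurableSet {V | y ∈ LF V}) (hm0 : 0 < m) (hm1 : m ≤ 1)
    (hLFu : ∀ y ∈ T, ∀ y' ∈ T, y' ≠ y → ∀ (V : GaugeConfig 4 M G) (a : G),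
      (y' ∈ LF (Function.update V (y, 2) (V (y, 2) * a)) ↔ y' ∈ LF V))
    (hS₁ : MeasurableSet S₁)
    (hcrit : ∀ y ∈ T, ∀ (V : GaugeConfig 4 M G) (a : G),
      V (y, 2) * a * (V (y.shift 2, 3) * (V (y.shift 3, 2))⁻¹ * (V (y, 3))⁻¹) ∈ S₁ →
        y ∈ LF (Function.update V (y, 2) (V (y, 2) * a)))
    {y : Site 4 M} (hy : y ∈ T) :
    κ₀ * m * (haarProbability G).real S₁ *
        ∫ V, Ψ V * ∏ y' ∈ T, (if y' ∈ LF V then m else 1) ∂(Measure.pi fun _ : Edge 4 M => haarProbability G) ≤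
      ∫ V, Ψ V * (∏ y' ∈ T, (if y' ∈ LF V then m else 1)) * (if y ∈ LF V then 1 else 0)
        ∂Measure.pi fun _ : Edge 4 M => haarProbability G := by
  have hHm : Measurable fun V : GaugeConfig 4 M G =>
      Ψ V * (∏ y' ∈ T, (if y' ∈ LF V then m else 1)) * (if y ∈ LF V then (1 : ℝ) else 0) :=
    (hΨm.mul (measurable_prod_ite_mem hLFm m)).mul (Measurable.ite (hLFm y) measurable_const measurable_const)
  have hHb : ∀ V : GaugeConfig 4 M G,
      |Ψ V * (∏ y' ∈ T, (if y' ∈ LF V then m else 1)) * (if y ∈ LF V then (1 : ℝ) else 0)| ≤ 1 := fun V => by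
    rw [abs_mul, abs_mul, abs_of_pos (hΨ0 _), abs_of_nonneg (prod_ite_mem_nonneg T LF hm0.le _)]
    refine mul_le_one₀ (mul_le_one₀ (hΨ1 _) (prod_ite_mem_nonneg T LF hm0.le _)
      (prod_ite_mem_le_one T LF hm0.le hm1 _)) (abs_nonneg _) ?_
    split_ifs <;> norm_num
  rw [integral_eq_integral_average (μ := Measure.pi fun _ : Edge 4 M => haarProbability G)
    (ν := haarProbability G) (Φ := fun a V => Function.update V (y, 2) (V (y, 2) * a))
    (measurable_linkUpdate₂ (y, 2)) (measurePreserving_linkUpdate (y, 2)) hHm hHb, ← integral_const_mul]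
  exact integral_mono ((integrable_weight_mul_prod hΨm hΨ0 hΨ1 hLFm hm0.le).const_mul _)
    (integrable_average (measurable_linkUpdate₂ (y, 2)) hHm hHb)
    fun V => le_integral_integrand_update hΨm hΨ0 hΨ1 hκ₀ hΨu hLFm hm0 hm1 hLFu hS₁ hcrit hy V

/-- **Growth of the normalised moment.** For `0 < m ≤ 1`, `ratio ≥ 1` and `δ = κ₀ m Haar(S₁)`:
`(1 + (ratio - 1) δ #T) ∫ Ψ m^X ≤ ∫ Ψ (m·ratio)^X` — Bernoulli `ratio^X ≥ 1 + (ratio-1) X`,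
`X = ∑_{y ∈ T} 1[y ∈ LF]`, then the density bound site by site. [folklore] -/
theorem growth_integral_weight_mul_prod (hΨm : Measurable Ψ) (hΨ0 : ∀ V, 0 < Ψ V) (hΨ1 : ∀ V, Ψ V ≤ 1)
    (hκ₀ : 0 ≤ κ₀)
    (hΨu : ∀ y ∈ T, ∀ (V : GaugeConfig 4 M G) (a : G), κ₀ * Ψ V ≤ Ψ (Function.update V (y, 2) (V (y, 2) * a)))
    (hLFm : ∀ y, MeasurableSet {V | y ∈ LF V}) (hm0 : 0 < m) (hm1 : m ≤ 1)
    (hLFu : ∀ y ∈ T, ∀ y' ∈ T, y' ≠ y → ∀ (V : GaugeConfig 4 M G) (a : G),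
      (y' ∈ LF (Function.update V (y, 2) (V (y, 2) * a)) ↔ y' ∈ LF V))
    (hS₁ : MeasurableSet S₁)
    (hcrit : ∀ y ∈ T, ∀ (V : GaugeConfig 4 M G) (a : G),
      V (y, 2) * a * (V (y.shift 2, 3) * (V (y.shift 3, 2))⁻¹ * (V (y, 3))⁻¹) ∈ S₁ →
        y ∈ LF (Function.update V (y, 2) (V (y, 2) * a)))
    {r : ℝ} (hr : 1 ≤ r) :
    (1 + (r - 1) * (κ₀ * m * (haarProbability G).real S₁) * T.card) *
        ∫ V, Ψ V * ∏ y ∈ T, (if y ∈ LF V then m else 1) ∂(Measure.pi fun _ : Edge 4 M => haarProbability G) ≤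
      ∫ V, Ψ V * ∏ y ∈ T, (if y ∈ LF V then m * r else 1) ∂Measure.pi fun _ : Edge 4 M => haarProbability G := by
  set μ : Measure (GaugeConfig 4 M G) := Measure.pi fun _ => haarProbability G with hμ
  set δ : ℝ := κ₀ * m * (haarProbability G).real S₁ with hδ
  set I₁ : ℝ := ∫ V, Ψ V * ∏ y ∈ T, (if y ∈ LF V then m else 1) ∂μ with hI₁
  -- pointwise Bernoulli
  have hpt : ∀ V, Ψ V * (∏ y ∈ T, (if y ∈ LF V then m else 1)) + (r - 1) * ∑ y ∈ T,
      Ψ V * (∏ y' ∈ T, (if y' ∈ LF V then m else 1)) * (if y ∈ LF V then 1 else 0) ≤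
        Ψ V * ∏ y ∈ T, (if y ∈ LF V then m * r else 1) := by
    intro V
    rw [prod_ite_mem_mul, ← Finset.mul_sum]
    have h := one_add_mul_sum_le_prod T LF hr V
    have h0 : 0 ≤ Ψ V * ∏ y ∈ T, (if y ∈ LF V then m else 1) :=
      mul_nonneg (hΨ0 V).le (prod_ite_mem_nonneg T LF hm0.le V)
    calc Ψ V * (∏ y ∈ T, (if y ∈ LF V then m else 1)) + (r - 1) * (Ψ V *
          (∏ y' ∈ T, (if y' ∈ LF V then m else 1)) * ∑ y ∈ T, (if y ∈ LF V then (1 : ℝ) else 0))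
        = Ψ V * (∏ y ∈ T, (if y ∈ LF V then m else 1)) *
            (1 + (r - 1) * ∑ y ∈ T, (if y ∈ LF V then (1 : ℝ) else 0)) := by ring
      _ ≤ Ψ V * (∏ y ∈ T, (if y ∈ LF V then m else 1)) * ∏ y ∈ T, (if y ∈ LF V then r else 1) :=
          mul_le_mul_of_nonneg_left h h0
      _ = _ := by ring
  -- integrability of the summands
  have hint : ∀ y, Integrable (fun V => Ψ V * (∏ y' ∈ T, (if y' ∈ LF V then m else 1)) *
      (if y ∈ LF V then (1 : ℝ) else 0)) μ := fun y => by
    refine integrable_of_abs_le ((hΨm.mul (measurable_prod_ite_mem hLFm m)).mul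
      (Measurable.ite (hLFm y) measurable_const measurable_const)).aestronglyMeasurable
      (C := max 1 m ^ T.card) fun V => ?_
    rw [abs_mul]
    refine (mul_le_of_le_one_right (abs_nonneg _) ?_).trans (abs_weight_mul_prod_le hΨ0 hΨ1 hm0.le V)
    split_ifs <;> norm_num
  have hsum : Integrable (fun V => (r - 1) * ∑ y ∈ T,
      Ψ V * (∏ y' ∈ T, (if y' ∈ LF V then m else 1)) * (if y ∈ LF V then (1 : ℝ) else 0)) μ :=
    (integrable_finsetSum T fun y _ => hint y).const_mul (r - 1)
  calc (1 + (r - 1) * δ * T.card) * I₁ = I₁ + (r - 1) * ∑ _y ∈ T, δ * I₁ := by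
        rw [Finset.sum_const, nsmul_eq_mul]; ring
    _ ≤ I₁ + (r - 1) * ∑ y ∈ T, ∫ V, Ψ V * (∏ y' ∈ T, (if y' ∈ LF V then m else 1)) *
          (if y ∈ LF V then 1 else 0) ∂μ :=
        add_le_add le_rfl (mul_le_mul_of_nonneg_left (Finset.sum_le_sum fun y hy =>
          integral_weight_mul_prod_indicator_ge hΨm hΨ0 hΨ1 hκ₀ hΨu hLFm hm0 hm1 hLFu hS₁ hcrit hy)
            (sub_nonneg.2 hr))
    _ = ∫ V, (Ψ V * (∏ y ∈ T, (if y ∈ LF V then m else 1)) + (r - 1) * ∑ y ∈ T,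
          Ψ V * (∏ y' ∈ T, (if y' ∈ LF V then m else 1)) * (if y ∈ LF V then 1 else 0)) ∂μ := by
        rw [integral_add (integrable_weight_mul_prod hΨm hΨ0 hΨ1 hLFm hm0.le) hsum, integral_const_mul,
          integral_finsetSum _ fun y _ => hint y]
    _ ≤ _ := integral_mono ((integrable_weight_mul_prod hΨm hΨ0 hΨ1 hLFm hm0.le).add hsum)
          (integrable_weight_mul_prod hΨm hΨ0 hΨ1 hLFm (mul_nonneg hm0.le (by linarith))) hpt

end Growth

end SignedFormat

/-! ### Registered sub-goal carried by this file -/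

/-- **Registered sub-goal of Stub N3 carried by this support file** — tail-site gauge averaging
for `SU(3)` block configurations (`SignedFormat.integral_weight_mul_prod_apply_eq`): under a
gauge-invariant weight the links `V(y,1)`, `y ∈ T`, are i.i.d. Haar given the pattern `T ∩ LF V`. [folklore] -/
theorem stub_formatBallClustering_signAveraging : ∀ (M : ℕ) [NeZero M] (T : Finset (Site 4 M)) (LF : GaugeConfig 4 M ↥(Matrix.specialUnitaryGroup (Fin 3) ℂ) → Finset (Site 4 M)) (Ψ : GaugeConfig 4 M ↥(Matrix.specialUnitaryGroup (Fin 3) ℂ) → ℝ) (f : ↥(Matrix.specialUnitaryGroup (Fin 3) ℂ) → ℝ), (∀ y ∈ T, ∀ y' ∈ T, y'.shift 1 ≠ y) → (∀ (g : Site 4 M → ↥(Matrix.specialUnitaryGroup (Fin 3) ℂ)) V, LF (gaugeTransform g V) = LF V) → (∀ y, MeasurableSet {V | y ∈ LF V}) → Measurable Ψ → (∀ V, |Ψ V| ≤ 1) → (∀ (g : Site 4 M → ↥(Matrix.specialUnitaryGroup (Fin 3) ℂ)) V, Ψ (gaugeTransform g V) = Ψ V) → Measurable f → (∀ u, |f u|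 ≤ 1) → ∫ V, Ψ V * ∏ y ∈ T, (if y ∈ LF V then f (V (y, 1)) else 1) ∂Measure.pi (fun _ : Edge 4 M => haarProbability ↥(Matrix.specialUnitaryGroup (Fin 3) ℂ)) = ∫ V, Ψ V * ∏ y ∈ T, (if y ∈ LF V then ∫ u, f u ∂haarProbability ↥(Matrix.specialUnitaryGroup (Fin 3) ℂ) else 1) ∂Measure.pi fun _ : Edge 4 M => haarProbability ↥(Matrix.specialUnitaryGroup (Fin 3) ℂ) :=
  fun _ _ _ _ _ _ hT hLFg hLFm hΨm hΨ1 hΨg hf hf1 =>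
    SignedFormat.integral_weight_mul_prod_apply_eq hT hLFg hLFm hΨm hΨ1 hΨg hf hf1

end Summit.QuantumFields.QCD.Cruxes.RobustYangMillsRG.Birth
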